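import Mathlib
import Summits.MatrixMultiplication.MatrixMultiplication.Theorems.LevelGradedCohnUmansLevelOneGL2DesignsStubTangencySetsHermitianReduction

/-!
# The unital bound for `stub_tangencySets`, part 1: line counts of a point set in `AG(2,q)`

Wall-breaker axis "Hermitian unital constructions" (k7/12) for the stub `stub_tangencySets` of the
crux `LevelOneGL2Designs` (stmt-MatrixMultiplication-14080, route LevelGradedCohnUmans).

The stub's matrix `f.1 ⬝ᵥ f'.2 = 1 ↔ f = f'` is an induced matching between non-zero points of the
affine plane over a field `F` and its origin-avoiding lines `{z | u ⬝ᵥ z = t}`.  This file is the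
counting kit for the Illés–Szőnyi–Wettl / Thas argument in that affine, origin-anchored
normalisation, over an arbitrary finite field `F` with `q` elements.  Lines are represented
REDUNDANTLY by pairs `(u, t)` with `u ≠ 0` (each line `q - 1` times), which keeps everything a finite
sum over vectors — no projective quotients:

* `card_filter_dotProduct_left`, `card_ne_zero_orth`, `card_ne_zero_dotProduct_eq`,
  `card_ne_zero_pairs`, `card_ne_zero_dotProduct_eq_dotProduct` — how many (non-zero) normal vectors
  `u` satisfy `u ⬝ᵥ z = t`, resp. `u ⬝ᵥ z = u ⬝ᵥ z'`;
* for a point set `X ∌ 0`: the first moments `sum_card_filter_orth` (lines through the origin meet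
  `X` in `(q-1)|X|` points, with multiplicity), `sum_card_filter_pairs` (the other lines:
  `(q²-q)|X|`), and the second moment `sum_sum_sq_card_filter`
  (`Σ #{z ∈ X | u ⬝ᵥ z = t}² = (q-1)|X|² + (q²-q)|X|`: two points lie on one line).

Part 2 (`…UnitalBound.lean`) turns these into `q|S|² ≤ (q²-1)²` and its integer refinement; part 3
(`…UnitalBoundExact.lean`) records that the Hermitian unital attains the bound exactly when `q` is a
square and evaluates it at small primes.  Elementary double counting; Mathlib plus `card_line` of
the sibling file `…StubTangencySetsHermitianReduction`; no definitions.
-/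

-- `Summit.MatrixMultiplication.MatrixMultiplication.…` is the tree's mandated summit/problem namespace (D-0017).
set_option linter.dupNamespace false

namespace Summit.MatrixMultiplication.MatrixMultiplication.Theorems.LevelOneGL2Designs.UnitalBound

open Finset Matrix
open Summit.MatrixMultiplication.MatrixMultiplication.Theorems.LevelOneGL2Designs.FlagLine.TangencyHermitian
  (card_line)

variable {F : Type*} [Field F] [Fintype F] [DecidableEq F]

/-! ## Counting normal vectors -/

/-- For `z ≠ 0` and any `t`, exactly `|F|` vectors `u` satisfy `u ⬝ᵥ z = t`. [elementary] -/
theorem card_filter_dotProduct_left {z : Fin 2 → F} (hz : z ≠ 0) (t : F) :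
    (univ.filter fun u : Fin 2 → F => u ⬝ᵥ z = t).card = Fintype.card F := by
  simp_rw [dotProduct_comm _ z]
  exact card_line z hz t

/-- The plane `F²` has `|F|² - 1` non-zero vectors. [elementary] -/
theorem card_filter_ne_zero :
    (univ.filter fun u : Fin 2 → F => u ≠ 0).card = Fintype.card F ^ 2 - 1 := by
  rw [filter_ne' univ (0 : Fin 2 → F), card_erase_of_mem (mem_univ _), card_univ,
    Fintype.card_fun, Fintype.card_fin]

/-- For `z ≠ 0`, exactly `|F| - 1` non-zero vectors `u` satisfy `u ⬝ᵥ z = 0`. [elementary] -/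
theorem card_ne_zero_orth {z : Fin 2 → F} (hz : z ≠ 0) :
    ((univ.filter fun u : Fin 2 → F => u ≠ 0).filter fun u => u ⬝ᵥ z = 0).card
      = Fintype.card F - 1 := by
  have h : ((univ.filter fun u : Fin 2 → F => u ≠ 0).filter fun u => u ⬝ᵥ z = 0)
      = (univ.filter fun u : Fin 2 → F => u ⬝ᵥ z = 0).erase 0 := by
    ext u
    simp only [mem_filter, mem_univ, true_and, mem_erase]
  rw [h, card_erase_of_mem (by simp), card_filter_dotProduct_left hz 0]

/-- For `z ≠ 0` and `t ≠ 0`, exactly `|F|` non-zero vectors `u` satisfy `u ⬝ᵥ z = t` (every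
solution is non-zero). [elementary] -/
theorem card_ne_zero_dotProduct_eq {z : Fin 2 → F} (hz : z ≠ 0) {t : F} (ht : t ≠ 0) :
    ((univ.filter fun u : Fin 2 → F => u ≠ 0).filter fun u => u ⬝ᵥ z = t).card
      = Fintype.card F := by
  have h : ((univ.filter fun u : Fin 2 → F => u ≠ 0).filter fun u => u ⬝ᵥ z = t)
      = (univ.filter fun u : Fin 2 → F => u ⬝ᵥ z = t) := by
    ext u
    simp only [mem_filter, mem_univ, true_and, and_iff_right_iff_imp]
    rintro h rfl
    rw [zero_dotProduct] at h
    exact ht h.symm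
  rw [h, card_filter_dotProduct_left hz t]

/-- For `z ≠ 0`, exactly `|F|² - |F|` pairs `(u, t)` with `u ≠ 0`, `t ≠ 0` satisfy
`u ⬝ᵥ z = t`. [elementary] -/
theorem card_ne_zero_pairs {z : Fin 2 → F} (hz : z ≠ 0) :
    (((univ.filter fun u : Fin 2 → F => u ≠ 0) ×ˢ (univ.filter fun t : F => t ≠ 0)).filter
        fun l => l.1 ⬝ᵥ z = l.2).card = Fintype.card F ^ 2 - Fintype.card F := by
  -- the pairs are `(u, u ⬝ᵥ z)` with `u ≠ 0` and `u ⬝ᵥ z ≠ 0`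
  have h : (((univ.filter fun u : Fin 2 → F => u ≠ 0) ×ˢ (univ.filter fun t : F => t ≠ 0)).filter
        fun l => l.1 ⬝ᵥ z = l.2)
      = (((univ.filter fun u : Fin 2 → F => u ≠ 0).filter fun u => u ⬝ᵥ z ≠ 0)).image
          fun u => (u, u ⬝ᵥ z) := by
    ext ⟨u, t⟩
    simp only [mem_filter, mem_product, mem_univ, true_and, mem_image, Prod.mk.injEq]
    constructor
    · rintro ⟨⟨hu, ht⟩, rfl⟩
      exact ⟨u, ⟨hu, ht⟩, rfl, rfl⟩
    · rintro ⟨u', ⟨hu', ht'⟩, rfl, rfl⟩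
      exact ⟨⟨hu', ht'⟩, rfl⟩
  rw [h, card_image_of_injective _ (fun u u' huu' => (Prod.mk.inj huu').1)]
  have hsplit := card_filter_add_card_filter_not
    (s := (univ.filter fun u : Fin 2 → F => u ≠ 0)) (fun u => u ⬝ᵥ z = 0)
  rw [card_ne_zero_orth hz, card_filter_ne_zero] at hsplit
  have h1 : 1 ≤ Fintype.card F := Fintype.card_pos
  have h2 : Fintype.card F ≤ Fintype.card F ^ 2 := by nlinarith
  -- `(q - 1) + x = q² - 1` gives `x = q² - q`
  have : ((univ.filter fun u : Fin 2 → F => u ≠ 0).filter fun u => ¬ u ⬝ᵥ z = 0).card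
      = Fintype.card F ^ 2 - Fintype.card F := by omega
  convert this using 2


/-- For fixed `z, z'`, the number of non-zero `u` with `u ⬝ᵥ z = u ⬝ᵥ z'` is `|F| - 1`, plus
`|F|² - |F|` more when `z = z'` (then every non-zero `u` qualifies). [elementary] -/
theorem card_ne_zero_dotProduct_eq_dotProduct {z z' : Fin 2 → F} (hzz : z ≠ z' ∨ z ≠ 0) :
    ((univ.filter fun u : Fin 2 → F => u ≠ 0).filter fun u => u ⬝ᵥ z = u ⬝ᵥ z').card
      = (Fintype.card F - 1) + if z = z' then Fintype.card F ^ 2 - Fintype.card F else 0 := by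
  split_ifs with h
  · subst h
    rw [filter_true_of_mem (fun u _ => rfl), card_filter_ne_zero]
    have h1 : 1 ≤ Fintype.card F := Fintype.card_pos
    have h2 : Fintype.card F ≤ Fintype.card F ^ 2 := by nlinarith
    omega
  · have hsub : z - z' ≠ 0 := sub_ne_zero.2 h
    have : ((univ.filter fun u : Fin 2 → F => u ≠ 0).filter fun u => u ⬝ᵥ z = u ⬝ᵥ z')
        = ((univ.filter fun u : Fin 2 → F => u ≠ 0).filter fun u => u ⬝ᵥ (z - z') = 0) := by
      ext u
      simp only [mem_filter, dotProduct_sub, sub_eq_zero]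
    rw [this, card_ne_zero_orth hsub, add_zero]

omit [Field F] in
/-- `∑_t 𝟙(a = t ∧ b = t) = 𝟙(a = b)`. [elementary] -/
theorem sum_ite_eq_and_eq (a b : F) :
    ∑ t : F, (if a = t ∧ b = t then (1 : ℕ) else 0) = if a = b then 1 else 0 := by
  by_cases hab : a = b
  · subst hab
    simp only [and_self]
    rw [sum_ite_eq]
    simp
  · rw [if_neg hab]
    refine sum_eq_zero fun t _ => ?_
    rw [if_neg]
    rintro ⟨rfl, rfl⟩
    exact hab rfl

/-! ## Line counts of a point set avoiding the origin -/

section PointSet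

/-- Lines through the origin (normal vectors `u ≠ 0`, level `0`, each line counted `|F| - 1`
times) meet a point set `X ∌ 0` in `(|F| - 1)·|X|` points in total. [elementary] -/
theorem sum_card_filter_orth (X : Finset (Fin 2 → F)) (hX : ∀ z ∈ X, z ≠ 0) :
    ∑ u ∈ univ.filter (fun u : Fin 2 → F => u ≠ 0), (X.filter fun z => u ⬝ᵥ z = 0).card
      = (Fintype.card F - 1) * X.card := by
  calc ∑ u ∈ univ.filter (fun u : Fin 2 → F => u ≠ 0), (X.filter fun z => u ⬝ᵥ z = 0).card
      = ∑ u ∈ univ.filter (fun u : Fin 2 → F => u ≠ 0), ∑ z ∈ X,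
          (if u ⬝ᵥ z = 0 then 1 else 0) := by simp_rw [card_filter]
    _ = ∑ z ∈ X, ∑ u ∈ univ.filter (fun u : Fin 2 → F => u ≠ 0),
          (if u ⬝ᵥ z = 0 then 1 else 0) := sum_comm
    _ = ∑ z ∈ X, ((univ.filter fun u : Fin 2 → F => u ≠ 0).filter fun u => u ⬝ᵥ z = 0).card := by
        simp_rw [card_filter]
    _ = ∑ z ∈ X, (Fintype.card F - 1) := sum_congr rfl fun z hz => card_ne_zero_orth (hX z hz)
    _ = (Fintype.card F - 1) * X.card := by rw [sum_const, smul_eq_mul, mul_comm]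

/-- Lines avoiding the origin (pairs `(u, t)`, `u ≠ 0`, `t ≠ 0`, line `{z | u ⬝ᵥ z = t}`, each
line counted `|F| - 1` times) meet `X ∌ 0` in `(|F|² - |F|)·|X|` points in total. [elementary] -/
theorem sum_card_filter_pairs (X : Finset (Fin 2 → F)) (hX : ∀ z ∈ X, z ≠ 0) :
    ∑ l ∈ (univ.filter fun u : Fin 2 → F => u ≠ 0) ×ˢ (univ.filter fun t : F => t ≠ 0),
        (X.filter fun z => l.1 ⬝ᵥ z = l.2).card
      = (Fintype.card F ^ 2 - Fintype.card F) * X.card := by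
  set P := (univ.filter fun u : Fin 2 → F => u ≠ 0) ×ˢ (univ.filter fun t : F => t ≠ 0) with hP
  calc ∑ l ∈ P, (X.filter fun z => l.1 ⬝ᵥ z = l.2).card
      = ∑ l ∈ P, ∑ z ∈ X, (if l.1 ⬝ᵥ z = l.2 then 1 else 0) := by simp_rw [card_filter]
    _ = ∑ z ∈ X, ∑ l ∈ P, (if l.1 ⬝ᵥ z = l.2 then 1 else 0) := sum_comm
    _ = ∑ z ∈ X, (P.filter fun l => l.1 ⬝ᵥ z = l.2).card := by simp_rw [card_filter]
    _ = ∑ z ∈ X, (Fintype.card F ^ 2 - Fintype.card F) :=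
        sum_congr rfl fun z hz => card_ne_zero_pairs (hX z hz)
    _ = (Fintype.card F ^ 2 - Fintype.card F) * X.card := by rw [sum_const, smul_eq_mul, mul_comm]

/-- For a fixed normal vector `u`: `∑_t #{z ∈ X | u ⬝ᵥ z = t}² = #{(z,z') ∈ X² | u ⬝ᵥ z = u ⬝ᵥ z'}`.
[elementary] -/
theorem sum_sq_card_filter_eq (X : Finset (Fin 2 → F)) (u : Fin 2 → F) :
    ∑ t : F, (X.filter fun z => u ⬝ᵥ z = t).card ^ 2
      = ∑ z ∈ X, ∑ z' ∈ X, (if u ⬝ᵥ z = u ⬝ᵥ z' then 1 else 0) := by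
  calc ∑ t : F, (X.filter fun z => u ⬝ᵥ z = t).card ^ 2
      = ∑ t : F, ∑ z ∈ X, ∑ z' ∈ X,
          ((if u ⬝ᵥ z = t then 1 else 0) * (if u ⬝ᵥ z' = t then 1 else 0)) := by
        refine sum_congr rfl fun t _ => ?_
        rw [card_filter, sq, sum_mul_sum]
    _ = ∑ t : F, ∑ z ∈ X, ∑ z' ∈ X, (if u ⬝ᵥ z = t ∧ u ⬝ᵥ z' = t then 1 else 0) := by
        simp_rw [ite_zero_mul_ite_zero, mul_one]
    _ = ∑ z ∈ X, ∑ t : F, ∑ z' ∈ X, (if u ⬝ᵥ z = t ∧ u ⬝ᵥ z' = t then 1 else 0) := sum_comm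
    _ = ∑ z ∈ X, ∑ z' ∈ X, ∑ t : F, (if u ⬝ᵥ z = t ∧ u ⬝ᵥ z' = t then 1 else 0) :=
        sum_congr rfl fun z _ => sum_comm
    _ = ∑ z ∈ X, ∑ z' ∈ X, (if u ⬝ᵥ z = u ⬝ᵥ z' then 1 else 0) :=
        sum_congr rfl fun z _ => sum_congr rfl fun z' _ => sum_ite_eq_and_eq _ _

/-- **Second moment of the line counts.**  Summing `#{z ∈ X | u ⬝ᵥ z = t}²` over all `u ≠ 0`
and all `t` (every affine line counted `|F| - 1` times) gives
`(|F| - 1)|X|² + (|F|² - |F|)|X|` for `X ∌ 0`: ordered pairs of distinct points lie on one common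
line, a point lies on `|F| + 1` lines. [elementary] -/
theorem sum_sum_sq_card_filter (X : Finset (Fin 2 → F)) (hX : ∀ z ∈ X, z ≠ 0) :
    ∑ u ∈ univ.filter (fun u : Fin 2 → F => u ≠ 0), ∑ t : F, (X.filter fun z => u ⬝ᵥ z = t).card ^ 2
      = (Fintype.card F - 1) * X.card ^ 2 + (Fintype.card F ^ 2 - Fintype.card F) * X.card := by
  set NZ := univ.filter (fun u : Fin 2 → F => u ≠ 0) with hNZ
  calc ∑ u ∈ NZ, ∑ t : F, (X.filter fun z => u ⬝ᵥ z = t).card ^ 2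
      = ∑ u ∈ NZ, ∑ z ∈ X, ∑ z' ∈ X, (if u ⬝ᵥ z = u ⬝ᵥ z' then 1 else 0) :=
        sum_congr rfl fun u _ => sum_sq_card_filter_eq X u
    _ = ∑ z ∈ X, ∑ u ∈ NZ, ∑ z' ∈ X, (if u ⬝ᵥ z = u ⬝ᵥ z' then 1 else 0) := sum_comm
    _ = ∑ z ∈ X, ∑ z' ∈ X, ∑ u ∈ NZ, (if u ⬝ᵥ z = u ⬝ᵥ z' then 1 else 0) :=
        sum_congr rfl fun z _ => sum_comm
    _ = ∑ z ∈ X, ∑ z' ∈ X, (NZ.filter fun u => u ⬝ᵥ z = u ⬝ᵥ z').card := by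
        simp_rw [card_filter]
    _ = ∑ z ∈ X, ∑ z' ∈ X,
          ((Fintype.card F - 1) + if z = z' then Fintype.card F ^ 2 - Fintype.card F else 0) :=
        sum_congr rfl fun z hz => sum_congr rfl fun z' _ =>
          card_ne_zero_dotProduct_eq_dotProduct (Or.inr (hX z hz))
    _ = ∑ z ∈ X, ((Fintype.card F - 1) * X.card + (Fintype.card F ^ 2 - Fintype.card F)) := by
        refine sum_congr rfl fun z hz => ?_
        rw [sum_add_distrib, sum_const, smul_eq_mul, sum_ite_eq, if_pos hz, mul_comm]
    _ = (Fintype.card F - 1) * X.card ^ 2 + (Fintype.card F ^ 2 - Fintype.card F) * X.card := by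
        rw [sum_const, smul_eq_mul]
        ring

end PointSet

end Summit.MatrixMultiplication.MatrixMultiplication.Theorems.LevelOneGL2Designs.UnitalBound
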